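import Literature.AlgebraicGeometry.Motives.AbelianVarietyDegree
import Literature.AlgebraicGeometry.Morphisms.FormalFunctions
import HarnessLib

/-!
# Everywhere-regular rational functions on an integral `K`-scheme with `Γ(X, 𝒪_X) = K` are constant

Topic `Literature/AlgebraicGeometry/Motives`, namespace `Literature.AlgebraicGeometry.Motives.RatFn` (the rational-function
currency of `CartierDivisor.lean`: `RatFn.toFunctionField`, `RatFn.IsRegularAt`, `RatFn.IsUnitAt`, `RatFn.algebraStalk`).
THEOREMS ONLY (no definition, no named fact, no instance; net Literature debt 0).  Cell `hodgecm-mathlib` (D-0151), road W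
toward `r₀` (item `stmt-HodgeConjecture-24834`), leaf **(W0) Lγ** of B-p18's `W0-SPEC` §3 («CONSTANCY + EVALUATION»), consumed
by (W0) L4c («on a proper group variety every nowhere-vanishing top form is translation invariant»: the ratio
`c := Φ^*(pr₂^*θ)/pr₂^*θ ∈ K(E × E)` is a unit at every point, hence a constant by `Γ(E × E, 𝒪) = K` (leaf Lβ), and it is `1`
because its germ along the slice `{e} × E` has residue `1`).  Banked capital; no floor change.

For an integral scheme `X` over a field `K` (Mathlib `X.Over (Spec K)`) whose global functions are the constants —
hypothesis `hΓ : Function.Surjective (Morphisms.algebraMapΓ (X ↘ Spec K))`, which is how leaf Lβ delivers «`Γ(X, 𝒪_X) = K`» for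
`X` proper, geometrically integral with a `K`-point; NO properness is used here — we prove:

* `exists_algebraMap_eq_of_forall_isRegularAt` — a rational function regular at every point is a constant `c ∈ K`
  (it is a global section by `Γ(X, 𝒪) = ⋂ₓ 𝒪_{X,x}`, ★ `RatFn.exists_germ_eq_of_forall_isRegularAt`, then `hΓ`);
* `exists_units_algebraMap_eq_of_forall_isUnitAt` — a rational function that is a unit at every point is a constant `c ∈ Kˣ`;
* `toFunctionField_algebraMap`, `eq_algebraMap_of_toFunctionField_eq_algebraMap` — the germ of the constant `c` at any point `x`
  is `algebraMap K 𝒪_{X,x} c`;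
* `eq_of_toFunctionField_eq_algebraMap_of_residue_eq`, `eq_one_of_toFunctionField_eq_algebraMap_of_residue_eq_one` — EVALUATION:
  the constant is read off in any residue field `κ(x)` (`K → κ(x)` is injective);
* `eq_one_of_forall_isUnitAt_of_residue_eq_one` — the consumer's one-liner: an everywhere-unit rational function whose germ at
  some point has residue `1` is `1`.

HC_CM is proved only modulo the 7 printed citations until rung 0 closes.

## References
* [GortzWedhorn2020] U. Görtz, T. Wedhorn, *Algebraic Geometry I: Schemes*, 2nd ed. (2020): Prop. 3.29 (p. 102) (`Γ(U, 𝒪) = ⋂ 𝒪_{X,x}`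
  inside `K(X)`); §(4.11) Prop. 4.41 ff. (`K`-schemes and their function algebras).
* [Hartshorne1977] R. Hartshorne, *Algebraic Geometry*, GTM 52 (1977): I Thm. 3.4 (a) (p. 18) (regular functions on a projective
  variety are constant); II §2 (residue fields `k(x)`, p. 74).
-/

universe u

open CategoryTheory AlgebraicGeometry TopologicalSpace Opposite

noncomputable section

namespace Literature.AlgebraicGeometry.Motives

namespace RatFn

variable {K : Type u} [Field K] {X : Scheme.{u}} [IsIntegral X] [X.Over (Spec (.of K))]

/-! ### The germ of a constant -/

/-- The germ at `x` of the constant rational function `c` is the constant `c` of `𝒪_{X,x}`: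
`𝒪_{X,x} → K(X)` maps `algebraMap K 𝒪_{X,x} c` to `algebraMap K K(X) c` (the scalar tower `K → 𝒪_{X,x} → K(X)` of
`CartierDivisor.lean`). [cite: GortzWedhorn2020, Prop. 3.29 (1)–(2) (p. 102)] -/
theorem toFunctionField_algebraMap (x : X) (c : K) :
    toFunctionField x (algebraMap K (X.presheaf.stalk x) c) = algebraMap K X.functionField c :=
  (IsScalarTower.algebraMap_apply K (X.presheaf.stalk x) X.functionField c).symm

/-- If the germ `t ∈ 𝒪_{X,x}` represents the constant rational function `c`, then `t` IS the constant `c` of `𝒪_{X,x}`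
(`𝒪_{X,x} → K(X)` is injective). [cite: GortzWedhorn2020, Prop. 3.29 (1) (p. 102)] -/
theorem eq_algebraMap_of_toFunctionField_eq_algebraMap {x : X} {t : X.presheaf.stalk x} {c : K}
    (ht : toFunctionField x t = algebraMap K X.functionField c) :
    t = algebraMap K (X.presheaf.stalk x) c :=
  toFunctionField_injective x (by rw [ht, toFunctionField_algebraMap])

/-! ### Evaluation: the constant is read off in any residue field -/

/-- **Evaluation.**  If the germ `t ∈ 𝒪_{X,x}` of the constant rational function `c` has the same residue in `κ(x)` as the
constant `d`, then `c = d` — because `K → 𝒪_{X,x} → κ(x)` is a ring map out of a field, hence injective.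
[cite: Hartshorne1977, II §2 (p. 74), residue field k(x); I Thm. 3.4 (a) (p. 18)] -/
theorem eq_of_toFunctionField_eq_algebraMap_of_residue_eq {x : X} {t : X.presheaf.stalk x} {c d : K}
    (ht : toFunctionField x t = algebraMap K X.functionField c)
    (hres : IsLocalRing.residue (X.presheaf.stalk x) t =
      IsLocalRing.residue (X.presheaf.stalk x) (algebraMap K (X.presheaf.stalk x) d)) :
    c = d := by
  rw [eq_algebraMap_of_toFunctionField_eq_algebraMap ht] at hres
  exact ((IsLocalRing.residue (X.presheaf.stalk x)).comp (algebraMap K (X.presheaf.stalk x))).injective hres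

/-- **Evaluation at `1`.**  If the germ `t ∈ 𝒪_{X,x}` of the constant rational function `c` has residue `1` in `κ(x)`, then
`c = 1`. [cite: Hartshorne1977, II §2 (p. 74), residue field k(x); I Thm. 3.4 (a) (p. 18)] -/
theorem eq_one_of_toFunctionField_eq_algebraMap_of_residue_eq_one {x : X} {t : X.presheaf.stalk x} {c : K}
    (ht : toFunctionField x t = algebraMap K X.functionField c)
    (h1 : IsLocalRing.residue (X.presheaf.stalk x) t = 1) : c = 1 :=
  eq_of_toFunctionField_eq_algebraMap_of_residue_eq ht (by rw [h1, map_one, map_one])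

/-! ### Constancy under `Γ(X, 𝒪_X) = K` -/

/-- **Constancy.**  On an integral `K`-scheme all of whose global functions are constants (`hΓ`: the structure map
`K → Γ(X, 𝒪_X)` is onto — e.g. `X` proper and geometrically integral with a `K`-point, leaf Lβ), a rational function which is
regular at EVERY point is a constant: it is a global section (`Γ(X, 𝒪) = ⋂ₓ 𝒪_{X,x}` in `K(X)`,
`RatFn.exists_germ_eq_of_forall_isRegularAt`), i.e. the image of some `c ∈ K`.
[cite: GortzWedhorn2020, Prop. 3.29 (3) (p. 102)] [cite: Hartshorne1977, I Thm. 3.4 (a) (p. 18)] -/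
theorem exists_algebraMap_eq_of_forall_isRegularAt
    (hΓ : Function.Surjective (Morphisms.algebraMapΓ (X ↘ Spec (.of K))))
    (h : X.functionField) (hh : ∀ x : X, IsRegularAt x h) :
    ∃ c : K, algebraMap K X.functionField c = h := by
  -- `h` is a global section
  obtain ⟨σ, hσ⟩ := exists_germ_eq_of_forall_isRegularAt (X := X) (U := ⊤) (Set.mem_univ _) (h := h)
    fun y _ => hh y
  -- every global section is a constant
  obtain ⟨c, hc⟩ := hΓ σ
  refine ⟨c, ?_⟩
  calc algebraMap K X.functionField c
      = X.presheaf.germ ⊤ (genericPoint X) trivial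
          ((X ↘ Spec (.of K)).appTop ((Scheme.ΓSpecIso (.of K)).inv c)) :=
        algebraMap_stalk_apply K (genericPoint X) c
    _ = X.presheaf.germ ⊤ (genericPoint X) (Set.mem_univ _) σ := by rw [← hc]; rfl
    _ = h := hσ

/-- **Constancy for everywhere-unit rational functions** (W0-SPEC Lγ «CONSTANCY»): on an integral `K`-scheme with
`Γ(X, 𝒪_X) = K` (`hΓ`), a rational function which is a UNIT at every point is a nonzero constant `c ∈ Kˣ`.
[cite: GortzWedhorn2020, Prop. 3.29 (3) (p. 102)] [cite: Hartshorne1977, I Thm. 3.4 (a) (p. 18)] -/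
theorem exists_units_algebraMap_eq_of_forall_isUnitAt
    (hΓ : Function.Surjective (Morphisms.algebraMapΓ (X ↘ Spec (.of K))))
    (h : X.functionField) (hh : ∀ x : X, IsUnitAt x h) :
    ∃ c : Kˣ, algebraMap K X.functionField (c : K) = h := by
  obtain ⟨c, hc⟩ := exists_algebraMap_eq_of_forall_isRegularAt hΓ h fun x => (hh x).isRegularAt
  have hc0 : c ≠ 0 := by
    rintro rfl
    exact (hh (genericPoint X)).ne_zero (by rw [← hc, map_zero])
  exact ⟨Units.mk0 c hc0, hc⟩

/-- **Lγ, the consumer's form (CONSTANCY + EVALUATION).**  On an integral `K`-scheme with `Γ(X, 𝒪_X) = K` (`hΓ`), a rational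
function `h` which is a unit at every point and whose germ `t` at SOME point `z` (e.g. the generic point of an integral closed
subscheme along which `h` «restricts to 1») has residue `1` in `κ(z)`, IS the constant `1`.
[cite: GortzWedhorn2020, Prop. 3.29 (3) (p. 102)] [cite: Hartshorne1977, I Thm. 3.4 (a) (p. 18)] -/
theorem eq_one_of_forall_isUnitAt_of_residue_eq_one
    (hΓ : Function.Surjective (Morphisms.algebraMapΓ (X ↘ Spec (.of K))))
    (h : X.functionField) (hh : ∀ x : X, IsUnitAt x h)
    {z : X} {t : X.presheaf.stalk z} (ht : toFunctionField z t = h)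
    (h1 : IsLocalRing.residue (X.presheaf.stalk z) t = 1) : h = 1 := by
  obtain ⟨c, hc⟩ := exists_units_algebraMap_eq_of_forall_isUnitAt hΓ h hh
  rw [← hc] at ht ⊢
  rw [eq_one_of_toFunctionField_eq_algebraMap_of_residue_eq_one ht h1, map_one]

/-- The same with the regularity hypothesis only (a rational function regular everywhere whose germ at some point has residue
`1` is `1`). [cite: GortzWedhorn2020, Prop. 3.29 (3) (p. 102)] [cite: Hartshorne1977, I Thm. 3.4 (a) (p. 18)] -/
theorem eq_one_of_forall_isRegularAt_of_residue_eq_one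
    (hΓ : Function.Surjective (Morphisms.algebraMapΓ (X ↘ Spec (.of K))))
    (h : X.functionField) (hh : ∀ x : X, IsRegularAt x h)
    {z : X} {t : X.presheaf.stalk z} (ht : toFunctionField z t = h)
    (h1 : IsLocalRing.residue (X.presheaf.stalk z) t = 1) : h = 1 := by
  obtain ⟨c, hc⟩ := exists_algebraMap_eq_of_forall_isRegularAt hΓ h hh
  rw [← hc] at ht ⊢
  rw [eq_one_of_toFunctionField_eq_algebraMap_of_residue_eq_one ht h1, map_one]

end RatFn

end Literature.AlgebraicGeometry.Motives

end
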